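import Literature.MathematicalPhysics.QuantumFieldTheory.Balaban1983to89.B6Hprime2101TwoScaleV1Torus
import Literature.MathematicalPhysics.QuantumFieldTheory.Balaban1983to89.B6DeltaPrimeKernelTorus

/-!
# `Balaban1983to89.B6DeltaPrimeKernelTwoScaleV1` — T. Bałaban, *Propagators and renormalization transformations for lattice gauge
# theories. II*, Commun. Math. Phys. **96** (1984) 223–250 [Balaban1984PropagatorsII], p. 242 after (2.108): *«From this we get an
# exponential decay of Δ′_j(y − y′)»* — FOR THE CONCRETE `Δ′_j = H′_j*Δ²H′_j` OF THE TWO-SCALE DATA `tsV1`: its kernel `⟨e_y, Δ′_je_{y′}⟩`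
# IS `θ·Re Δ′_j(y, y′)` of r03's typed torus operator (`θ = (c/L^j)⁴L^{jd}`), hence decays exponentially, uniformly in the volume

statement-level skeleton of published theorems with citation tags; proofs where landed; nothing here is a claim about the Yang–Mills mass gap

PDF held: `paper:balaban1984-cmp96-propagators-rt-ii` (journal page = PDF page + 222; p. 242 [PDF 20] read AS IMAGE on the ×2 render
`run/shared/lean/pub/pub-balaban/b2b-balaban-ref1/pages/1984-cmp96-propagators-rt-II/…-p020-x2.png`, 2026-08-21).

PRINT (verbatim, p. 242).  *"… the operator Δ′_j was defined by the second equality, Δ′_j = H′_j*Δ²H′_j. (2.107) In momentum representation on the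
unit lattice the operator Δ′_j is represented as the multiplication operator by the function Δ′_j(p′) = … (2.108) From this we get an exponential
decay of Δ′_j(y − y′) and the bound … (2.109)"*

CITATION HEADER (lean-in-tree rule) — WHAT IS REPRODUCED.  Phase-2 file of the `lit-balaban` typed skeleton (HOME
`run/shared/lean/pub/lit-balaban/`), seat **p22 gen 11** (B6 fold owner r03, referee ref-4; lane = the Sect. C chain (2.95)–(2.147) on the
concrete two-scale data `tsV1`).  SKELETON row **B6.Eq2.108** (decay sentence; decl of record r03's `…B6DeltaPrimeKernelTorus.norm_dPOp_le` for the
TYPED torus operator `dPOp`, untouched — THIS FILE is its model instance for the concrete `Δ′_j` of the V1 two-scale data).  IMPORTS BY NAME: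
r03's `…B6Hprime2101TorusAlgebra.eq2107_typed` ((2.107) `HpOpᴴ·Δ·Δ·HpOp = n^d·dPOp`) and `…B6DeltaPrimeKernelTorus.norm_dPOp_le` (decay of the
entries of `dPOp` at lattice representatives, dimension written `d + 1`), gen 9's dictionary `…B6Hprime2101TwoScaleV1Torus.transport_hP_eq_HpOp` /
`LapS_transport_ofLp` / `star_transport_dotProduct_transport` / `lapE_eq_smul`, p21's `B5LaplaceSpectral.LapS_isHermitian`,
`B6LowerBound2153Torus.toT/rep/toT_rep` (lattice representatives).  THIS FILE:
* §1 **`inner_Dp_eq_dPOp₂`** (the bilinear dictionary): `⟨ω, Δ′_jω′⟩ = θ·Re⟨ω̃, dPOp (L^j) (Mk P j) ω̃′⟩`, `ω̃ = cplxS (tSc ω)`, `θ = (c/L^j)⁴L^{jd}`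
  (`inner_Dp_eq₂`: `⟨ω, Δ′_jω′⟩ = ⟨ΔH′_jω, ΔH′_jω′⟩`; `inner_lapE_lapE_eq`: the Laplacian weight);
* §2 **`inner_single_Dp_single`**: THE KERNEL of the concrete `Δ′_j` in the site basis is `⟨e_y, Δ′_je_{y′}⟩ = θ·Re Δ′_j(y, y′)` (`dPOp` entry);
* §3 **`kernel_Dp_decay`** / **`kernel_Dp_decay_rep`** (parameter set written `⟨d + 1, L, m, K⟩`, as r03's torus sup-metric is indexed by
  `Fin (d + 1)`; every `P : Params` has this form): `|⟨e_{x̄}, Δ′_je_{ȳ}⟩| ≤ θ·M_Δ′(d+1)·periodConst(κ_N(d+1), d)·e^{−(κ_N(d+1)/(d+1))|x − y|_{T,∞}}`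
  for lattice representatives `x, y ∈ ℤ^{d+1}` (resp. for all sites via `rep`), uniformly in the volume, `Λ′` and the weights.
THEOREMS ONLY (no definition, no `def … : Prop` fact); standard axioms.  HONEST SCOPE: an ENTRY bound in the torus sup-metric of r03's lineage with
its crude d-only constants (not the paper's), times the V1 normalisation `θ` (print: unit normalisation); the kernel is that of the typed form `Dp`
of gen 7's `TwoScaleData` on the whole unit torus `T^{(j)}` (the restriction to admissible `ω` plays no role for the kernel); finite tori of the V1
calculus, centred blocks (`L` odd); NOT summit progress.
-/

noncomputable section

open scoped InnerProductSpace Matrix ComplexConjugate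

namespace Literature.MathematicalPhysics.QuantumFieldTheory.Balaban1983to89.B6DeltaPrimeKernelTwoScaleV1

open LatticeFieldCalculus B5SectBStatements B5Eq117TorusCarriers B6SectAOperatorsV1 B6SectCTwoScaleV1 B6SectCTwoScaleV1Lattice
open B6SectCOperators (TwoScaleData)
open B5Prop11Plancherel (Tor fine)
open B5Action121 (LapS)
open B5LaplaceSpectral (LapS_isHermitian)
open B5TowerOneStroke (towerE trS)
open B4TorusKernel (periodConst)
open B4TorusKernel.MultiPeriod (torusSupNorm)
open B5Hk163Strip (kappaN)
open B6LowerBound2153Torus (toT rep toT_rep)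
open B6Hprime2132Torus (HpOp)
open B6Hprime2101 (MdP)
open B6Hprime2101TorusAlgebra (dPOp eq2107_typed)
open B6DeltaPrimeKernelTorus (norm_dPOp_le)
open B6Hprime2101TwoScaleV1Torus (transport_hP_eq_HpOp LapS_transport_ofLp star_transport_dotProduct_transport lapE_eq_smul
  transportC_apply)

variable {d : ℕ}

/-- matrix algebra: `⟨Au, Av⟩ = ⟨u, (AᴴA)v⟩`. [folklore] -/
private theorem star_mulVec_dotProduct_mulVec {m k : Type*} [Fintype m] [Fintype k] (A : Matrix m k ℂ) (u v : k → ℂ) :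
    star (A *ᵥ u) ⬝ᵥ (A *ᵥ v) = star u ⬝ᵥ ((Aᴴ * A) *ᵥ v) := by
  rw [Matrix.star_mulVec, Matrix.dotProduct_mulVec, Matrix.vecMul_vecMul, ← Matrix.dotProduct_mulVec]

/-- `star e_y = e_y` for the unit vector `e_y = Pi.single y 1`. [folklore] -/
private theorem star_single_one {ι : Type*} [DecidableEq ι] (y : ι) :
    star (Pi.single y (1 : ℂ) : ι → ℂ) = (Pi.single y (1 : ℂ) : ι → ℂ) := by
  funext x
  rw [Pi.star_apply]
  by_cases hx : x = y
  · subst hx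
    rw [Pi.single_eq_same, star_one]
  · rw [Pi.single_eq_of_ne hx, star_zero]

/-! ## §1  The bilinear dictionary: `⟨ω, Δ′_jω′⟩ = θ·Re⟨ω̃, dPOp ω̃′⟩` -/

section V1

variable {P : Params} {c : ℝ} (hc : c ≠ 0) {j : ℕ} (Λ' : Finset (Site P (j + 1))) (w : CIdx j Λ' → ℝ)

/-- **(2.107) as a bilinear form for the two-scale data**: `⟨ω, Δ′_jω′⟩ = ⟨ΔH′_jω, ΔH′_jω′⟩` (`Δ = lapE c`, `H′_j = hP`).
[cite: Balaban1984PropagatorsII, (2.107) p.242] -/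
theorem inner_Dp_eq₂ (ω ω' : USite P j) :
    ⟪ω, (tsV1 hc Λ' w).Dp ω'⟫_ℝ = ⟪lapE c (hP hc j ω), lapE c (hP hc j ω')⟫_ℝ := by
  rw [TwoScaleData.Dp]
  simp only [LinearMap.coe_comp, Function.comp_apply]
  rw [LinearMap.adjoint_inner_right]
  show ⟪hP hc j ω, lapE c (lapE c (hP hc j ω'))⟫_ℝ = ⟪lapE c (hP hc j ω), lapE c (hP hc j ω')⟫_ℝ
  rw [inner_lapE_right c (hP hc j ω) (lapE c (hP hc j ω')), ← real_inner_comm (lapE c (hP hc j ω)) (lapE c (hP hc j ω')),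
    inner_lapE_right c (lapE c (hP hc j ω')) (hP hc j ω)]
  exact real_inner_comm _ _

omit hc in
/-- the Laplacian weight: `⟨lapE c f, lapE c g⟩ = (c/L^k)⁴⟨lapE (L^k) f, lapE (L^k) g⟩` for every `k`. [cite: Balaban1984PropagatorsII, (2.8) p.224] -/
theorem inner_lapE_lapE_eq (k : ℕ) (f g : ScalarSpace P) :
    ⟪lapE c f, lapE c g⟫_ℝ = (c / (P.L : ℝ) ^ k) ^ 4 * ⟪lapE ((P.L : ℝ) ^ k) f, lapE ((P.L : ℝ) ^ k) g⟫_ℝ := by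
  have hL : (0 : ℝ) < (P.L : ℝ) ^ k := pow_pos P.cast_L_pos _
  have h1 : ∀ f : ScalarSpace P, lapE c f = (c / (P.L : ℝ) ^ k) ^ 2 • lapE ((P.L : ℝ) ^ k) f := fun f => by
    rw [lapE_eq_smul c, lapE_eq_smul ((P.L : ℝ) ^ k), smul_smul]
    congr 1
    field_simp
  rw [h1 f, h1 g, real_inner_smul_left, real_inner_smul_right]
  ring

/-- **the bilinear dictionary**: `⟨ω, Δ′_jω′⟩ = (c/L^j)⁴·L^{jd}·Re⟨ω̃, dPOp (L^j) (Mk P j) ω̃′⟩`, `ω̃ = cplxS (tSc ω)` the complexified unit-lattice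
field ((2.107) for the concrete operators = r03's `eq2107_typed` after gen 9's `(H′_jμ)~ = HpOp·μ̃` and `Δ(λ̃) = (lapE (L^j) λ)~`).
[cite: Balaban1984PropagatorsII, (2.107)–(2.108) p.242] -/
theorem inner_Dp_eq_dPOp₂ (hj : j ≤ P.m + P.K) (ω ω' : USite P j) :
    ⟪ω, (tsV1 hc Λ' w).Dp ω'⟫_ℝ = (c / (P.L : ℝ) ^ j) ^ 4 * ((P.L : ℝ) ^ j) ^ P.d *
      (star (cplxS (tSc (WithLp.ofLp ω))) ⬝ᵥ (dPOp (P.L ^ j) (Mk P j) *ᵥ cplxS (tSc (WithLp.ofLp ω')))).re := by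
  -- the transported Laplacians: `⟨lapE (L^j) f, lapE (L^j) g⟩ = Re⟨Δ f̃, Δ g̃⟩`
  have hLap : ∀ f g : ScalarSpace P, ⟪lapE ((P.L : ℝ) ^ j) f, lapE ((P.L : ℝ) ^ j) g⟫_ℝ =
      (star (LapS (fine (P.L ^ j) (Mk P j)) ((P.L ^ j : ℕ) : ℂ) *ᵥ trS (towerE P.L (Mk P j) j) (cplxS (tS hj (WithLp.ofLp f)))) ⬝ᵥ
        (LapS (fine (P.L ^ j) (Mk P j)) ((P.L ^ j : ℕ) : ℂ) *ᵥ trS (towerE P.L (Mk P j) j) (cplxS (tS hj (WithLp.ofLp g))))).re := by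
    intro f g
    rw [LapS_transport_ofLp, LapS_transport_ofLp, star_transport_dotProduct_transport, Complex.ofReal_re, inner_eq_sum]
  -- `⟨Δ HpOp u, Δ HpOp v⟩ = n^d ⟨u, dPOp v⟩`
  have h2 : ∀ u v : Tor (Mk P j) → ℂ,
      star (LapS (fine (P.L ^ j) (Mk P j)) ((P.L ^ j : ℕ) : ℂ) *ᵥ (HpOp (P.L ^ j) (Mk P j) *ᵥ u)) ⬝ᵥ
          (LapS (fine (P.L ^ j) (Mk P j)) ((P.L ^ j : ℕ) : ℂ) *ᵥ (HpOp (P.L ^ j) (Mk P j) *ᵥ v)) =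
        ((P.L ^ j : ℕ) : ℂ) ^ P.d * (star u ⬝ᵥ (dPOp (P.L ^ j) (Mk P j) *ᵥ v)) := by
    intro u v
    have h7 := eq2107_typed (P.L ^ j) (Mk P j)
    simp only [Matrix.mul_assoc] at h7
    rw [Matrix.mulVec_mulVec, Matrix.mulVec_mulVec, star_mulVec_dotProduct_mulVec, Matrix.conjTranspose_mul,
      (LapS_isHermitian _ _).eq, Matrix.mul_assoc, h7, Matrix.smul_mulVec, dotProduct_smul, smul_eq_mul]
  have hcast : ((P.L ^ j : ℕ) : ℂ) ^ P.d = ((((P.L : ℝ) ^ j) ^ P.d : ℝ) : ℂ) := by push_cast; ring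
  rw [inner_Dp_eq₂, inner_lapE_lapE_eq j, hLap, transport_hP_eq_HpOp hc hj ω, transport_hP_eq_HpOp hc hj ω', h2, hcast,
    Complex.re_ofReal_mul]
  ring

/-! ## §2  The kernel of the concrete `Δ′_j` in the site basis -/

omit hc in
/-- the complexified unit vector `e_y` of the V1 carrier is `Pi.single y 1` (as a function on `Tor (Mk P j)` = `Site P j`). [folklore] -/
private theorem transportC_single (y : Site P j) :
    cplxS (tSc (WithLp.ofLp (EuclideanSpace.single y (1 : ℝ)))) = @Pi.single (Tor (Mk P j)) (fun _ => ℂ) _ _ y 1 := by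
  funext x
  rw [transportC_apply, PiLp.ofLp_single]
  by_cases hx : x = y
  · subst hx
    rw [Pi.single_eq_same, Pi.single_eq_same, Complex.ofReal_one]
  · have hx' : ¬ @Eq (Site P j) x y := hx
    rw [Pi.single_eq_of_ne hx', Pi.single_eq_of_ne hx, Complex.ofReal_zero]

/-- **THE KERNEL OF THE CONCRETE `Δ′_j`**: in the site basis `e_y` of the unit torus, `⟨e_y, Δ′_je_{y′}⟩ = θ·Re Δ′_j(y, y′)`, `Δ′_j(y, y′)` the
entry of r03's typed `dPOp (L^j) (Mk P j)`, `θ = (c/L^j)⁴L^{jd}`. [cite: Balaban1984PropagatorsII, (2.108) p.242] -/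
theorem inner_single_Dp_single (hj : j ≤ P.m + P.K) (y y' : Site P j) :
    ⟪EuclideanSpace.single y (1 : ℝ), (tsV1 hc Λ' w).Dp (EuclideanSpace.single y' (1 : ℝ))⟫_ℝ =
      (c / (P.L : ℝ) ^ j) ^ 4 * ((P.L : ℝ) ^ j) ^ P.d * (dPOp (P.L ^ j) (Mk P j) y y').re := by
  rw [inner_Dp_eq_dPOp₂ hc Λ' w hj, transportC_single, transportC_single, star_single_one, Matrix.mulVec_single_one,
    single_one_dotProduct, Matrix.col_apply]

/-! ## §3  «an exponential decay of Δ′_j(y − y′)» for the concrete `Δ′_j` -/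

end V1

section Decay

/-! r03's torus sup-metric `torusSupNorm` and entry decay `norm_dPOp_le` are written with the dimension as `d + 1`; accordingly the parameter
set is written here as `⟨d + 1, L, m, K, _, _⟩` — EVERY `P : Params` is of this form (`P.hd : 1 ≤ P.d`; destructure `P` to apply). -/

variable {d L m K : ℕ} {hd : 1 ≤ d + 1} {hL : Odd L ∧ 1 < L} {c : ℝ} (hc : c ≠ 0) {j : ℕ}
  (Λ' : Finset (Site (⟨d + 1, L, m, K, hd, hL⟩ : Params) (j + 1))) (w : CIdx j Λ' → ℝ)

/-- **«AN EXPONENTIAL DECAY OF Δ′_j(y − y′)» FOR THE CONCRETE `Δ′_j` OF THE TWO-SCALE DATA**: on the unit torus `T^{(j)}` of the parameter set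
`(d + 1, L, m, K)`, for two sites `y, y′` with lattice representatives `x, x′ ∈ ℤ^{d+1}`, `|⟨e_y, Δ′_je_{y′}⟩| ≤ θ·M_Δ′(d+1)·periodConst(κ_N(d+1), d)·
e^{−(κ_N(d+1)/(d+1))|x − x′|_{T,∞}}`, `θ = (c/L^j)⁴L^{j(d+1)}` — uniformly in the volume, in `Λ′` and in the weights (r03's `norm_dPOp_le` BY NAME
through `inner_single_Dp_single`). [cite: Balaban1984PropagatorsII, (2.108) p.242] -/
theorem kernel_Dp_decay (hj : j ≤ m + K) (y y' : Site (⟨d + 1, L, m, K, hd, hL⟩ : Params) j) (x x' : Fin (d + 1) → ℤ)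
    (hx : toT (Mk ⟨d + 1, L, m, K, hd, hL⟩ j) x = y) (hx' : toT (Mk ⟨d + 1, L, m, K, hd, hL⟩ j) x' = y') :
    |⟪EuclideanSpace.single y (1 : ℝ), (tsV1 hc Λ' w).Dp (EuclideanSpace.single y' (1 : ℝ))⟫_ℝ| ≤
      (c / (L : ℝ) ^ j) ^ 4 * ((L : ℝ) ^ j) ^ (d + 1) *
        (MdP (d + 1) * periodConst (kappaN (d + 1)) d *
          Real.exp (-(kappaN (d + 1) / (d + 1) * torusSupNorm (Mk ⟨d + 1, L, m, K, hd, hL⟩ j) (x - x')))) := by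
  subst hx hx'
  haveI : NeZero ((⟨d + 1, L, m, K, hd, hL⟩ : Params).L ^ j) := ⟨pow_ne_zero _ (show L ≠ 0 by have := hL.2; omega)⟩
  have hθ : 0 ≤ (c / ((⟨d + 1, L, m, K, hd, hL⟩ : Params).L : ℝ) ^ j) ^ 4 *
      (((⟨d + 1, L, m, K, hd, hL⟩ : Params).L : ℝ) ^ j) ^ (⟨d + 1, L, m, K, hd, hL⟩ : Params).d := by positivity
  have h1 := inner_single_Dp_single hc Λ' w hj (toT (Mk ⟨d + 1, L, m, K, hd, hL⟩ j) x) (toT (Mk ⟨d + 1, L, m, K, hd, hL⟩ j) x')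
  have h2 := norm_dPOp_le ((⟨d + 1, L, m, K, hd, hL⟩ : Params).L ^ j) (Mk ⟨d + 1, L, m, K, hd, hL⟩ j) x x'
  rw [h1, abs_mul, abs_of_nonneg hθ]
  exact mul_le_mul_of_nonneg_left ((Complex.abs_re_le_norm _).trans h2) hθ

/-- the same with the box representatives `rep` of the two sites (`toT ∘ rep = id`). [cite: Balaban1984PropagatorsII, (2.108) p.242] -/
theorem kernel_Dp_decay_rep (hj : j ≤ m + K) (y y' : Site (⟨d + 1, L, m, K, hd, hL⟩ : Params) j) :
    |⟪EuclideanSpace.single y (1 : ℝ), (tsV1 hc Λ' w).Dp (EuclideanSpace.single y' (1 : ℝ))⟫_ℝ| ≤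
      (c / (L : ℝ) ^ j) ^ 4 * ((L : ℝ) ^ j) ^ (d + 1) *
        (MdP (d + 1) * periodConst (kappaN (d + 1)) d *
          Real.exp (-(kappaN (d + 1) / (d + 1) *
            torusSupNorm (Mk ⟨d + 1, L, m, K, hd, hL⟩ j) (rep (Mk ⟨d + 1, L, m, K, hd, hL⟩ j) y - rep (Mk ⟨d + 1, L, m, K, hd, hL⟩ j) y')))) :=
  kernel_Dp_decay hc Λ' w hj y y' _ _ (toT_rep _ y) (toT_rep _ y')

end Decay

end Literature.MathematicalPhysics.QuantumFieldTheory.Balaban1983to89.B6DeltaPrimeKernelTwoScaleV1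

end
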